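import Literature.AnabelianGeometry.AbsoluteAnabelian.ArchimedeanReconstructionCor28Sub
import Literature.AnabelianGeometry.AbsoluteAnabelian.ArchimedeanReconstructionAutHolWitness

/-!
# FACT-LIST rows F-0059 `NFCurveData.CauchyEquiv`, F-0062 `NFCurveData.PolesAvoid` — kernel status

PROOF-ONLY companion (abc-iut seat f-092, F fact-proving wave, rung LADDER-ABC:A2.C) of
`ArchimedeanReconstruction.lean` (abc-iut-L4 lineage, p408225 / v2 p414800, FROZEN; imported, never edited or
restated) for the two FROZEN FACT-LIST rows of S. Mochizuki, *Topics in Absolute Anabelian Geometry III*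
[AbsTopIII], Corollary 2.8 (a), kurims manuscript p. 63 (lit key `paper:url-5493eb38cbb7`):

* **F-0062** `NFCurveData.PolesAvoid f S` — «NF-rational function … whose divisor of poles avoids `S`»;
* **F-0059** `NFCurveData.CauchyEquiv x y` — «two Cauchy sequences of NF-points which admit a common
  conductor will be called equivalent if … the [eventually finite] value sequences converge to the same
  element of `k_v`».

Both rows are DEFINITIONS of Cor 2.8 (a) — predicates with parameters over the interface shim `NFCurveData`
(outputs of Thm 1.9 (a), (d), (e)), classed `parametrised`; a predicate is consumable at NAMED INSTANCES only
(plan R5): the tree consumes `PolesAvoid` exclusively as a HYPOTHESIS binder (`IsCauchyWith`, `CauchyEquiv`,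
`N`, `HasPolarFunctions`) and `CauchyEquiv` as the relation defining `X^top` (`NFCurveData.Xtop`).  This file
records their complete kernel status AS TYPED:

1. UNIVERSAL CLOSURES REFUTED at the tree's witness datum `AutHolWitness.D₂` (two NF-points `Bool`, one
   NF-rational function with a pole at both, `ℚ ↪ ℝ`; abc-iut-w5-d011, p417599): `not_forall_polesAvoid`
   (a function with a pole on the conductor) and `not_forall_cauchyEquiv` (the constant sequences at the two
   points admit no common conductor); pointwise witnesses `AutHolWitness.not_polesAvoid_singleton`,
   `AutHolWitness.not_cauchyEquiv_const`.
2. INSTANCE FORMS PROVED for ALL data: `polesAvoid_empty` (empty conductor), `polesAvoid_singleton_iff`,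
   `polesAvoid_iff_of_forall_ne_none` (a function without poles avoids every `S`); `CauchyEquiv.isCauchy_left /
   isCauchy_right` (equivalent sequences are Cauchy), `cauchyEquiv_self_iff` («`x ~ x` iff `x` is Cauchy», with
   abc-iut-w5-d140's `cauchyEquiv_refl`, p414194), `CauchyEquiv.tendsto_unique` (the common limit along `f` is
   the limit of either value sequence).  Reflexivity / symmetry / transitivity-under-`HasPolarFunctions` are
   `cauchyEquiv_refl / _symm / _trans_of_hasPolarFunctions` of `ArchimedeanReconstructionCor28Sub.lean`.

Refuting the universal closure of a DEFINITION says nothing about print.  HONEST FRAMING: statements about OUR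
typed interface of a refereed prerequisite paper; no bearing on, and no side taken on, [IUTchIII] Cor 3.12;
typed ≠ proved; a FACT-LIST row is an assumption label, not an endorsement.
-/

noncomputable section

namespace Literature.AnabelianGeometry.AbsoluteAnabelian.ArchimedeanReconstruction

open _root_.Filter _root_.Topology

/-! ### F-0062 `NFCurveData.PolesAvoid` ([AbsTopIII] Cor 2.8 (a) p. 63) -/

/-- F-0062, INSTANCE FORM (PROVED for all data): every NF-rational function has its divisor of poles off the
EMPTY conductor ([AbsTopIII] Cor 2.8 (a) p. 63 «whose divisor of poles avoids `S`», `S = ∅`).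
[cite: MochizukiAbsTopIII2015, Corollary 2.8 (a) p.63] -/
theorem NFCurveData.polesAvoid_empty (D : NFCurveData) (f : D.Fn) : D.PolesAvoid f ∅ :=
  fun x hx => absurd hx (Finset.notMem_empty x)

/-- F-0062 at a one-point conductor: «the divisor of poles of `f` avoids `{x}`» iff `x` is not a pole of `f`
([AbsTopIII] Cor 2.8 (a) p. 63). [cite: MochizukiAbsTopIII2015, Corollary 2.8 (a) p.63] -/
theorem NFCurveData.polesAvoid_singleton_iff (D : NFCurveData) (f : D.Fn) (x : D.Pt) :
    D.PolesAvoid f {x} ↔ D.eval f x ≠ none := by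
  simp [NFCurveData.PolesAvoid]

/-- F-0062, INSTANCE FORM (PROVED): a function WITHOUT poles has its divisor of poles off every finite set
([AbsTopIII] Cor 2.8 (a) p. 63). [cite: MochizukiAbsTopIII2015, Corollary 2.8 (a) p.63] -/
theorem NFCurveData.polesAvoid_of_forall_ne_none (D : NFCurveData) {f : D.Fn}
    (hf : ∀ x : D.Pt, D.eval f x ≠ none) (S : Finset D.Pt) : D.PolesAvoid f S :=
  fun x _ => hf x

/-- F-0062, the divisor of poles avoids EVERY finite set iff the function has no pole at all
([AbsTopIII] Cor 2.8 (a) p. 63). [cite: MochizukiAbsTopIII2015, Corollary 2.8 (a) p.63] -/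
theorem NFCurveData.forall_polesAvoid_iff (D : NFCurveData) (f : D.Fn) :
    (∀ S : Finset D.Pt, D.PolesAvoid f S) ↔ ∀ x : D.Pt, D.eval f x ≠ none :=
  ⟨fun h x => (D.polesAvoid_singleton_iff f x).mp (h {x}), fun h S => D.polesAvoid_of_forall_ne_none h S⟩

/-- F-0062 fails pointwise at the witness datum `D₂` (abc-iut-w5-d011): its only function has a pole at
every NF-point, so its divisor of poles avoids no one-point conductor ([AbsTopIII] Cor 2.8 (a) p. 63; WITNESS
DATA, not a model of a curve). [cite: MochizukiAbsTopIII2015, Corollary 2.8 (a) p.63] -/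
theorem AutHolWitness.not_polesAvoid_singleton (b : Bool) (f : AutHolWitness.D₂.Fn) :
    ¬ AutHolWitness.D₂.PolesAvoid f {b} :=
  AutHolWitness.not_polesAvoid (Finset.singleton_nonempty b) f

/-- **F-0062, UNIVERSAL CLOSURE REFUTED** (closed form, kernel): it is NOT the case that every NF-rational
function of every datum has its divisor of poles off every finite set — at `D₂` the function has a pole ON
the conductor `{true}`.  The row is the DEFINITION «divisor of poles avoids `S`» of [AbsTopIII] Cor 2.8 (a)
p. 63, consumed only as a hypothesis; instance forms above. [cite: MochizukiAbsTopIII2015, Corollary 2.8 (a) p.63] -/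
theorem not_forall_polesAvoid :
    ¬ ∀ (D : NFCurveData) (f : D.Fn) (S : Finset D.Pt), D.PolesAvoid f S :=
  fun h => AutHolWitness.not_polesAvoid_singleton true () (h AutHolWitness.D₂ () {true})

/-! ### F-0059 `NFCurveData.CauchyEquiv` ([AbsTopIII] Cor 2.8 (a) p. 63) -/

/-- F-0059 (PROVED): an equivalent pair consists of Cauchy sequences — left member ([AbsTopIII] Cor 2.8 (a)
p. 63: equivalence is defined for «two Cauchy sequences of NF-points which admit a common conductor»).
[cite: MochizukiAbsTopIII2015, Corollary 2.8 (a) p.63] -/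
theorem NFCurveData.CauchyEquiv.isCauchy_left {D : NFCurveData} {x y : ℕ → D.Pt}
    (h : D.CauchyEquiv x y) : D.IsCauchy x := by
  obtain ⟨S, hx, -, -⟩ := h
  exact ⟨S, hx⟩

/-- F-0059 (PROVED): an equivalent pair consists of Cauchy sequences — right member ([AbsTopIII] Cor 2.8 (a)
p. 63). [cite: MochizukiAbsTopIII2015, Corollary 2.8 (a) p.63] -/
theorem NFCurveData.CauchyEquiv.isCauchy_right {D : NFCurveData} {x y : ℕ → D.Pt}
    (h : D.CauchyEquiv x y) : D.IsCauchy y := by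
  obtain ⟨S, -, hy, -⟩ := h
  exact ⟨S, hy⟩

/-- F-0059 (PROVED): equivalent sequences admit a COMMON conductor ([AbsTopIII] Cor 2.8 (a) p. 63 «which
admit a common conductor»). [cite: MochizukiAbsTopIII2015, Corollary 2.8 (a) p.63] -/
theorem NFCurveData.CauchyEquiv.exists_common_conductor {D : NFCurveData} {x y : ℕ → D.Pt}
    (h : D.CauchyEquiv x y) : ∃ S : Finset D.Pt, D.IsCauchyWith x S ∧ D.IsCauchyWith y S := by
  obtain ⟨S, hx, hy, -⟩ := h
  exact ⟨S, hx, hy⟩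

/-- F-0059, INSTANCE FORM on the diagonal (PROVED for all data): «`x` is equivalent to itself» iff `x` is a
Cauchy sequence of NF-points — with abc-iut-w5-d140's `cauchyEquiv_refl` (the values converge since `k_v` is
complete) ([AbsTopIII] Cor 2.8 (a) p. 63). [cite: MochizukiAbsTopIII2015, Corollary 2.8 (a) p.63] -/
theorem NFCurveData.cauchyEquiv_self_iff {D : NFCurveData} (x : ℕ → D.Pt) :
    D.CauchyEquiv x x ↔ D.IsCauchy x :=
  ⟨fun h => h.isCauchy_left, NFCurveData.cauchyEquiv_refl⟩

/-- F-0059 (PROVED): for an equivalent pair with common conductor witnessed inside the relation, along every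
`f` whose poles avoid that conductor BOTH value sequences converge, and any limit of one is a limit of the
other (`k_v` is Hausdorff) — the «same element of `k_v`» of [AbsTopIII] Cor 2.8 (a) p. 63 made usable.
[cite: MochizukiAbsTopIII2015, Corollary 2.8 (a) p.63] -/
theorem NFCurveData.CauchyEquiv.tendsto_iff {D : NFCurveData} {x y : ℕ → D.Pt} (h : D.CauchyEquiv x y) :
    ∃ S : Finset D.Pt, D.IsCauchyWith x S ∧ D.IsCauchyWith y S ∧ ∀ f : D.Fn, D.PolesAvoid f S →
      ∀ a : D.kv, Tendsto (fun j => D.valv f (x j)) atTop (𝓝 a) ↔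
        Tendsto (fun j => D.valv f (y j)) atTop (𝓝 a) := by
  obtain ⟨S, hx, hy, hS⟩ := h
  refine ⟨S, hx, hy, fun f hf a => ?_⟩
  obtain ⟨b, hxb, hyb⟩ := hS f hf
  constructor
  · intro hxa
    rwa [tendsto_nhds_unique hxa hxb]
  · intro hya
    rwa [tendsto_nhds_unique hya hyb]

/-- F-0059 fails pointwise at the witness datum `D₂` (abc-iut-w5-d011): the constant sequences at its two
NF-points are Cauchy (conductor = the other point) but NOT equivalent — a common conductor would have to avoid
both points, i.e. be empty, and the empty conductor forces the everywhere-polar function to have eventually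
finite values ([AbsTopIII] Cor 2.8 (a) p. 63; WITNESS DATA, not a model of a curve).
[cite: MochizukiAbsTopIII2015, Corollary 2.8 (a) p.63] -/
theorem AutHolWitness.not_cauchyEquiv_const :
    ¬ AutHolWitness.D₂.CauchyEquiv (fun _ => true) (fun _ => false) := by
  rintro ⟨S, hx, hy, -⟩
  obtain ⟨b, hb⟩ := AutHolWitness.conductor_nonempty hx
  obtain ⟨j, hj⟩ := (hx.eventually_not_mem.and hy.eventually_not_mem).exists
  cases b
  · exact hj.2 hb
  · exact hj.1 hb

/-- The constant sequences of `D₂` ARE Cauchy (so the failure above is a failure of EQUIVALENCE, not of the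
Cauchy property) ([AbsTopIII] Cor 2.8 (a) p. 63). [cite: MochizukiAbsTopIII2015, Corollary 2.8 (a) p.63] -/
theorem AutHolWitness.isCauchy_const (c : Bool) : AutHolWitness.D₂.IsCauchy (fun _ => c) :=
  (AutHolWitness.const c).2

/-- **F-0059, UNIVERSAL CLOSURE REFUTED** (closed form, kernel): it is NOT the case that any two sequences of
NF-points of any datum are equivalent — at `D₂` the two constant sequences are inequivalent Cauchy sequences.
The row is the DEFINITION «equivalent» of [AbsTopIII] Cor 2.8 (a) p. 63 (the relation whose classes form
`X^top`); its laws `cauchyEquiv_refl/symm/trans_of_hasPolarFunctions` are proved in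
`ArchimedeanReconstructionCor28Sub.lean`. [cite: MochizukiAbsTopIII2015, Corollary 2.8 (a) p.63] -/
theorem not_forall_cauchyEquiv :
    ¬ ∀ (D : NFCurveData) (x y : ℕ → D.Pt), D.CauchyEquiv x y :=
  fun h => AutHolWitness.not_cauchyEquiv_const (h _ _ _)

/-- F-0059, even the closure over CAUCHY pairs fails (kernel): two Cauchy sequences of the same datum need
not be equivalent — `X^top` of `D₂` has two points (abc-iut-w5-d011's `AutHolWitness.pt_true_ne_pt_false`)
([AbsTopIII] Cor 2.8 (a) p. 63). [cite: MochizukiAbsTopIII2015, Corollary 2.8 (a) p.63] -/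
theorem not_forall_isCauchy_cauchyEquiv :
    ¬ ∀ (D : NFCurveData) (x y : ℕ → D.Pt), D.IsCauchy x → D.IsCauchy y → D.CauchyEquiv x y :=
  fun h => AutHolWitness.not_cauchyEquiv_const
    (h _ _ _ (AutHolWitness.isCauchy_const true) (AutHolWitness.isCauchy_const false))

end Literature.AnabelianGeometry.AbsoluteAnabelian.ArchimedeanReconstruction

end
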